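import Literature.Analysis.FluidPDE.SelfSimilarEulerProfile
import Mathlib.Analysis.InnerProductSpace.Adjoint
import Mathlib.MeasureTheory.Integral.IntervalIntegral.FundThmCalculus
import HarnessLib

/-!
# Chae–Shvydkoy 2013, §4, eq. (4.1): a velocity field whose strain tends to zero at infinity
has sublinear radial component

Analysis/FluidPDE proof file (theorems only; no definitions, no named facts, no `sorry`): the
first step of the proof of Chae–Shvydkoy's vorticity exclusion theorem (Thm. 4.1, the tree's named
fact `chaeShvydkoy2013_vorticity_exclusion`, NOT discharged here):

* D. Chae, R. Shvydkoy, *On formation of a locally self-similar collapse in the incompressible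
  Euler equations*, ARMA **209** (2013) = arXiv:1201.6009 [ChaeShvydkoy2013], §4, proof of
  Thm. 4.1, eq. (4.1): "From (i) [`|ς(y)| = o(1)` as `|y| → ∞`, `ς = ½(∂ᵢvⱼ + ∂ⱼvᵢ)`] by the
  Fundamental Theorem of Calculus, the radial component of velocity is `|v_r(y)| = o(|y|)` as
  `|y| → ∞`. Indeed, `v(y) = v(0) + ∫₀¹ ∇v(ty)·y dt`. Then
  `v_r(y) = v(y)·y/|y| = v(0)·y/|y| + (1/|y|)∫₀¹ y·ς(ty)·y dt`."

Statements: `inner_sub_eq_integral_fderiv` (the FTC identity along the ray; the private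
`inner_fderiv_self_eq_inner_strain` gives `⟪DU(z)y, y⟫ = ⟪ς(z)y, y⟫`),
`exists_abs_inner_self_le_of_strain_tendsto_zero` (for every `δ > 0` there are `R, C` with
`|⟪U(y), y⟫| ≤ δ|y|² + C|y|` for `|y| ≥ R`), and the consequence used in the proof of Thm. 4.1,
`exists_inner_transport_self_ge` (`⟪γy + U(y), y⟫ ≥ (γ/2)|y|²` far out, `γ > 0`: the transport
field `V = γy + U` points outwards, so the inner boundary terms of the `L^p`-vorticity balance on
exterior regions have the favourable sign).

## Mathlib / tree search

Mathlib: `HasDerivAt.inner`, `intervalIntegral.integral_eq_sub_of_hasDerivAt`,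
`intervalIntegral.norm_integral_le_of_norm_le_const`, `ContinuousLinearMap.adjoint_inner_left`,
`Filter.mem_cocompact`. No tree declaration states (4.1) (`lean search 'strain.*cocompact'`).
No new definitions, no instances, no notation.
-/

noncomputable section

open MeasureTheory Set Filter Topology Metric InnerProductSpace
open scoped RealInnerProductSpace

namespace Literature.Analysis.FluidPDE

/-- `⟪DU(z) y, y⟫ = ⟪ς(z) y, y⟫` with the strain `ς(z) = ½(DU(z) + DU(z)ᵀ)`. [folklore] -/
private theorem inner_fderiv_self_eq_inner_strain
    (A : EuclideanSpace ℝ (Fin 3) →L[ℝ] EuclideanSpace ℝ (Fin 3)) (y : EuclideanSpace ℝ (Fin 3)) :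
    ⟪A y, y⟫ = ⟪((1 / 2 : ℝ) • (A + ContinuousLinearMap.adjoint A)) y, y⟫ := by
  rw [show ((1 / 2 : ℝ) • (A + ContinuousLinearMap.adjoint A)) y =
      (1 / 2 : ℝ) • (A y + ContinuousLinearMap.adjoint A y) from rfl, inner_smul_left,
    inner_add_left, ContinuousLinearMap.adjoint_inner_left, real_inner_comm y]
  simp only [conj_trivial]
  ring

/-- `|⟪DU(z) y, y⟫| ≤ ‖ς(z)‖ |y|²`. [folklore] -/
private theorem abs_inner_fderiv_self_le_norm_strain
    (A : EuclideanSpace ℝ (Fin 3) →L[ℝ] EuclideanSpace ℝ (Fin 3)) (y : EuclideanSpace ℝ (Fin 3)) :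
    |⟪A y, y⟫| ≤ ‖(1 / 2 : ℝ) • (A + ContinuousLinearMap.adjoint A)‖ * ‖y‖ ^ 2 := by
  rw [inner_fderiv_self_eq_inner_strain]
  calc |⟪((1 / 2 : ℝ) • (A + ContinuousLinearMap.adjoint A)) y, y⟫|
      ≤ ‖((1 / 2 : ℝ) • (A + ContinuousLinearMap.adjoint A)) y‖ * ‖y‖ := abs_real_inner_le_norm _ _
    _ ≤ ‖(1 / 2 : ℝ) • (A + ContinuousLinearMap.adjoint A)‖ * ‖y‖ * ‖y‖ := by
        gcongr
        exact ContinuousLinearMap.le_opNorm _ _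
    _ = ‖(1 / 2 : ℝ) • (A + ContinuousLinearMap.adjoint A)‖ * ‖y‖ ^ 2 := by ring

/-- **The FTC along the ray** (CS13: "`v(y) = v(0) + ∫₀¹ ∇v(ty)·y dt`", paired with `y`):
`⟪U(y), y⟫ − ⟪U(0), y⟫ = ∫₀¹ ⟪DU(ty) y, y⟫ dt` for `U ∈ C¹`.
[cite: ChaeShvydkoy2013, §4, proof of Thm. 4.1 (display after (4.1))] -/
theorem inner_sub_eq_integral_fderiv
    {U : EuclideanSpace ℝ (Fin 3) → EuclideanSpace ℝ (Fin 3)} (hU : ContDiff ℝ 1 U)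
    (y : EuclideanSpace ℝ (Fin 3)) :
    ⟪U y, y⟫ - ⟪U 0, y⟫ = ∫ t in (0 : ℝ)..1, ⟪fderiv ℝ U (t • y) y, y⟫ := by
  have hd : ∀ t : ℝ, HasDerivAt (fun t : ℝ => ⟪U (t • y), y⟫) ⟪fderiv ℝ U (t • y) y, y⟫ t := by
    intro t
    have h1 : HasDerivAt (fun t : ℝ => t • y) y t := by
      simpa using (hasDerivAt_id t).smul_const y
    have h2 : HasDerivAt (fun t : ℝ => U (t • y)) (fderiv ℝ U (t • y) y) t :=
      ((hU.differentiable one_ne_zero) (t • y)).hasFDerivAt.comp_hasDerivAt t h1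
    have h3 := h2.inner ℝ (hasDerivAt_const t y)
    simpa using h3
  have hcont : Continuous fun t : ℝ => ⟪fderiv ℝ U (t • y) y, y⟫ :=
    (((hU.continuous_fderiv one_ne_zero).comp (continuous_id.smul continuous_const)).clm_apply
      continuous_const).inner continuous_const
  rw [intervalIntegral.integral_eq_sub_of_hasDerivAt (fun t _ => hd t)
    (hcont.intervalIntegrable _ _)]
  simp

/-- **CS13 (4.1): sublinear radial velocity.** If `U ∈ C¹(ℝ³)` and its strain
`ς = ½(DU + DUᵀ)` tends to `0` at infinity (in operator norm, along the cocompact filter), then for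
every `δ > 0` there are `R` and `C` with `|⟪U(y), y⟫| ≤ δ|y|² + C|y|` for `|y| ≥ R` — i.e.
`U_r(y) = ⟪U(y), y/|y|⟫ = o(|y|)`. [cite: ChaeShvydkoy2013, §4, proof of Thm. 4.1, eq. (4.1)] -/
theorem exists_abs_inner_self_le_of_strain_tendsto_zero
    {U : EuclideanSpace ℝ (Fin 3) → EuclideanSpace ℝ (Fin 3)} (hU : ContDiff ℝ 1 U)
    (hS : Tendsto (fun y => ‖(1 / 2 : ℝ) • (fderiv ℝ U y + ContinuousLinearMap.adjoint
      (fderiv ℝ U y))‖) (cocompact (EuclideanSpace ℝ (Fin 3))) (𝓝 0))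
    {δ : ℝ} (hδ : 0 < δ) :
    ∃ R C : ℝ, 0 < R ∧ 0 ≤ C ∧ ∀ y : EuclideanSpace ℝ (Fin 3), R ≤ ‖y‖ →
      |⟪U y, y⟫| ≤ δ * ‖y‖ ^ 2 + C * ‖y‖ := by
  -- the strain is `< δ` outside a ball of radius `R₀`
  have hev : ∀ᶠ z in cocompact (EuclideanSpace ℝ (Fin 3)),
      ‖(1 / 2 : ℝ) • (fderiv ℝ U z + ContinuousLinearMap.adjoint (fderiv ℝ U z))‖ < δ :=
    hS.eventually (Iio_mem_nhds hδ)
  obtain ⟨K, hK, hKs⟩ := mem_cocompact.1 hev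
  obtain ⟨R₀, hR₀⟩ := hK.isBounded.subset_closedBall 0
  set R₁ : ℝ := max R₀ 1 with hR₁
  have hR₁0 : 0 < R₁ := lt_of_lt_of_le one_pos (le_max_right _ _)
  have hfar : ∀ z : EuclideanSpace ℝ (Fin 3), R₁ < ‖z‖ →
      ‖(1 / 2 : ℝ) • (fderiv ℝ U z + ContinuousLinearMap.adjoint (fderiv ℝ U z))‖ < δ := by
    intro z hz
    have hzK : z ∉ K := fun h => by
      have := hR₀ h
      rw [mem_closedBall_zero_iff] at this
      linarith [le_max_left R₀ 1]
    exact hKs hzK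
  -- a bound for `DU` on the ball of radius `R₁`
  have hDUc : Continuous (fderiv ℝ U) := hU.continuous_fderiv one_ne_zero
  obtain ⟨M, hM⟩ := (isCompact_closedBall (0 : EuclideanSpace ℝ (Fin 3)) R₁).exists_bound_of_continuousOn
    hDUc.continuousOn
  have hM0 : 0 ≤ M := le_trans (norm_nonneg _) (hM 0 (by simp [hR₁0.le]))
  -- the radius: `R = 2R₁/ ?`; we take `R = R₁` and `C = ‖U 0‖ + M R₁`... with the split at `t₀ = R₁/|y|`
  refine ⟨R₁, ‖U 0‖ + M * R₁, hR₁0, by positivity, fun y hy => ?_⟩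
  have hy0 : 0 < ‖y‖ := lt_of_lt_of_le hR₁0 hy
  set t₀ : ℝ := R₁ / ‖y‖ with ht₀
  have ht₀0 : 0 < t₀ := by positivity
  have ht₀1 : t₀ ≤ 1 := by rw [ht₀, div_le_one hy0]; exact hy
  have hcont : Continuous fun t : ℝ => ⟪fderiv ℝ U (t • y) y, y⟫ :=
    ((hDUc.comp (continuous_id.smul continuous_const)).clm_apply continuous_const).inner
      continuous_const
  have hFTC := inner_sub_eq_integral_fderiv hU y
  -- split the ray integral at `t₀`
  have hsplit : ∫ t in (0 : ℝ)..1, ⟪fderiv ℝ U (t • y) y, y⟫ =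
      (∫ t in (0 : ℝ)..t₀, ⟪fderiv ℝ U (t • y) y, y⟫) +
        ∫ t in t₀..1, ⟪fderiv ℝ U (t • y) y, y⟫ :=
    (intervalIntegral.integral_add_adjacent_intervals (hcont.intervalIntegrable _ _)
      (hcont.intervalIntegrable _ _)).symm
  -- near part: `|DU(ty) y · y| ≤ M |y|²` for `t ≤ t₀` (then `|ty| ≤ R₁`)
  have hnear : ‖∫ t in (0 : ℝ)..t₀, ⟪fderiv ℝ U (t • y) y, y⟫‖ ≤ M * ‖y‖ ^ 2 * |t₀ - 0| := by
    refine intervalIntegral.norm_integral_le_of_norm_le_const fun t ht => ?_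
    rw [uIoc_of_le ht₀0.le] at ht
    have htR : ‖t • y‖ ≤ R₁ := by
      rw [norm_smul, Real.norm_eq_abs, abs_of_pos ht.1]
      calc t * ‖y‖ ≤ t₀ * ‖y‖ := by gcongr; exact ht.2
        _ = R₁ := by rw [ht₀]; field_simp
    have h1 := hM (t • y) (by rw [mem_closedBall_zero_iff]; exact htR)
    rw [Real.norm_eq_abs]
    calc |⟪fderiv ℝ U (t • y) y, y⟫| ≤ ‖fderiv ℝ U (t • y) y‖ * ‖y‖ := abs_real_inner_le_norm _ _
      _ ≤ ‖fderiv ℝ U (t • y)‖ * ‖y‖ * ‖y‖ := by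
          gcongr; exact ContinuousLinearMap.le_opNorm _ _
      _ ≤ M * ‖y‖ * ‖y‖ := by gcongr
      _ = M * ‖y‖ ^ 2 := by ring
  -- far part: `|DU(ty) y · y| = |ς(ty) y · y| ≤ δ|y|²` for `t > t₀` (then `|ty| > R₁`)
  have hfarI : ‖∫ t in t₀..1, ⟪fderiv ℝ U (t • y) y, y⟫‖ ≤ δ * ‖y‖ ^ 2 * |1 - t₀| := by
    refine intervalIntegral.norm_integral_le_of_norm_le_const fun t ht => ?_
    rw [uIoc_of_le ht₀1] at ht
    have htpos : 0 < t := lt_trans ht₀0 ht.1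
    have htR : R₁ < ‖t • y‖ := by
      rw [norm_smul, Real.norm_eq_abs, abs_of_pos htpos]
      calc R₁ = t₀ * ‖y‖ := by rw [ht₀]; field_simp
        _ < t * ‖y‖ := by gcongr; exact ht.1
    have h1 := hfar (t • y) htR
    rw [Real.norm_eq_abs]
    calc |⟪fderiv ℝ U (t • y) y, y⟫|
        ≤ ‖(1 / 2 : ℝ) • (fderiv ℝ U (t • y) + ContinuousLinearMap.adjoint (fderiv ℝ U (t • y)))‖ *
            ‖y‖ ^ 2 := abs_inner_fderiv_self_le_norm_strain _ _
      _ ≤ δ * ‖y‖ ^ 2 := by gcongr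
  -- assemble
  have h0 : |⟪U 0, y⟫| ≤ ‖U 0‖ * ‖y‖ := abs_real_inner_le_norm _ _
  have ht₀abs : |t₀ - 0| = t₀ := by rw [sub_zero, abs_of_pos ht₀0]
  have h1abs : |1 - t₀| ≤ 1 := by rw [abs_of_nonneg (by linarith)]; linarith
  have hMy : M * ‖y‖ ^ 2 * t₀ = M * R₁ * ‖y‖ := by
    rw [ht₀]; field_simp
  rw [ht₀abs, hMy] at hnear
  have e : ⟪U y, y⟫ = ⟪U 0, y⟫ + ((∫ t in (0 : ℝ)..t₀, ⟪fderiv ℝ U (t • y) y, y⟫) +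
      ∫ t in t₀..1, ⟪fderiv ℝ U (t • y) y, y⟫) := by
    rw [← hsplit, ← hFTC]; ring
  rw [e]
  have hδy : 0 ≤ δ * ‖y‖ ^ 2 := by positivity
  calc |⟪U 0, y⟫ + ((∫ t in (0 : ℝ)..t₀, ⟪fderiv ℝ U (t • y) y, y⟫) +
        ∫ t in t₀..1, ⟪fderiv ℝ U (t • y) y, y⟫)|
      ≤ |⟪U 0, y⟫| + (|∫ t in (0 : ℝ)..t₀, ⟪fderiv ℝ U (t • y) y, y⟫| +
          |∫ t in t₀..1, ⟪fderiv ℝ U (t • y) y, y⟫|) :=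
        (abs_add_le _ _).trans (add_le_add le_rfl (abs_add_le _ _))
    _ ≤ ‖U 0‖ * ‖y‖ + (M * R₁ * ‖y‖ + δ * ‖y‖ ^ 2 * |1 - t₀|) := by
        rw [← Real.norm_eq_abs (∫ t in (0 : ℝ)..t₀, _), ← Real.norm_eq_abs (∫ t in t₀..1, _)]
        exact add_le_add h0 (add_le_add hnear hfarI)
    _ ≤ ‖U 0‖ * ‖y‖ + (M * R₁ * ‖y‖ + δ * ‖y‖ ^ 2 * 1) := by
        gcongr
    _ = δ * ‖y‖ ^ 2 + (‖U 0‖ + M * R₁) * ‖y‖ := by ring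

/-- **The transport field points outwards far out.** For `γ > 0` and `U ∈ C¹` with strain
tending to `0` at infinity: `⟪γy + U(y), y⟫ ≥ (γ/2)|y|²` for `|y| ≥ R` (take `δ = γ/4` in
(4.1) and `R ≥ 4C/γ`) — the sign of the inner boundary term `∫_{|y|=R} v_r |ω|^p dS_R` in CS13's
proof of Thm. 4.1 ("by choosing `R` sufficiently large, and using (i) and (4.1)").
[cite: ChaeShvydkoy2013, §4, proof of Thm. 4.1 (absorption step after (4.1))] -/
theorem exists_inner_transport_self_ge {γ : ℝ} (hγ : 0 < γ)
    {U : EuclideanSpace ℝ (Fin 3) → EuclideanSpace ℝ (Fin 3)} (hU : ContDiff ℝ 1 U)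
    (hS : Tendsto (fun y => ‖(1 / 2 : ℝ) • (fderiv ℝ U y + ContinuousLinearMap.adjoint
      (fderiv ℝ U y))‖) (cocompact (EuclideanSpace ℝ (Fin 3))) (𝓝 0)) :
    ∃ R : ℝ, 0 < R ∧ ∀ y : EuclideanSpace ℝ (Fin 3), R ≤ ‖y‖ →
      γ / 2 * ‖y‖ ^ 2 ≤ ⟪γ • y + U y, y⟫ := by
  obtain ⟨R, C, hR, hC, h⟩ := exists_abs_inner_self_le_of_strain_tendsto_zero hU hS
    (by positivity : 0 < γ / 4)
  refine ⟨max R (4 * C / γ), lt_of_lt_of_le hR (le_max_left _ _), fun y hy => ?_⟩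
  have hyR : R ≤ ‖y‖ := le_trans (le_max_left _ _) hy
  have hyC : 4 * C / γ ≤ ‖y‖ := le_trans (le_max_right _ _) hy
  have hy0 : 0 ≤ ‖y‖ := norm_nonneg _
  have h1 := h y hyR
  have h2 : -(γ / 4 * ‖y‖ ^ 2 + C * ‖y‖) ≤ ⟪U y, y⟫ := by
    have := neg_abs_le ⟪U y, y⟫
    linarith
  have hCy : C * ‖y‖ ≤ γ / 4 * ‖y‖ ^ 2 := by
    have : C ≤ γ / 4 * ‖y‖ := by
      rw [div_le_iff₀ hγ] at hyC
      linarith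
    nlinarith
  rw [inner_add_left, inner_smul_left, real_inner_self_eq_norm_sq]
  simp only [conj_trivial]
  linarith

end Literature.Analysis.FluidPDE
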